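import Summits.SmoothPoincare4.SmoothPoincare4.Theorems.SymplecticOrigamiOrigamiFoldExistenceStubOuterCleanRecognitionGlue
import Literature.Geometry.Manifold.InjOnLocalDiffeomorphInverse
import Literature.Geometry.Manifold.InjOnNhdsOfCompact
import Literature.Geometry.Manifold.StabilityOfEmbeddings
import Literature.Geometry.Manifold.SmoothEmbeddingInverse
import Mathlib.Geometry.Manifold.PartitionOfUnity

/-!
# Stub `stub_outerCleanRecognitionOfSide` of line `shadow-pleats` for crux `OrigamiFoldExistence` — R:
# a smooth map of a compact 4-manifold to `S⁴`, injective and immersive on a compact set `K` whose complement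
# lies in one chart, has a GLOBALLY SMOOTH left inverse near `K` (item stmt-SmoothPoincare4-7844; seat c4, wave 1)

Two folklore facts of differential topology, proved from the tree's Literature layer:

* `exists_isOpen_injOn_bijective_mfderiv` — a smooth `Ψ : M → S⁴` (`M` a compact `4`-manifold) which is
  injective on a compact `K` with injective differential at the points of `K` is injective with BIJECTIVE
  differential on an open neighbourhood of `K` (Hirsch's Lemma 1.3, `Literature.Geometry.Manifold.
  exists_isOpen_eventually_injOn_and_injective_mfderiv`, applied to `Subtype.val ∘ Ψ : M → ℝ⁵` as a constant
  family; injectivity near `K` by the tube-lemma fact `exists_isOpen_injOn_of_isCompact`; injective ⇒ bijective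
  for the differential by dimension count);
* `exists_contMDiff_leftInverse` — if moreover `M ∖ K` lies in the image of one chart `e₀ : ℝ⁴ ↪ M`, the smooth
  inverse `g = (Ψ|W)⁻¹` on the open image `Ψ(W)` (`contMDiffOn_invFunOn_of_bijective_mfderiv`) extends to a smooth
  `Φ : S⁴ → M` agreeing with `g` near `Ψ(K)`: with a smooth bump `χ` (`= 1` near `Ψ(K)`, `= 0` near `S⁴ ∖ Ψ(W)`)
  put `Φ = g` on `Ψ(K)` and `Φ = e₀ (χ • e₀⁻¹ ∘ g)` off `Ψ(K)` — off `Ψ(K)` the inverse `g` lands in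
  `W ∖ K ⊆ range e₀`, so the two recipes agree where `χ = 1`.
-/

noncomputable section

set_option linter.dupNamespace false

open scoped Manifold ContDiff Topology
open Set Function Filter Metric

namespace Summit.SmoothPoincare4.SmoothPoincare4.Theorems.OrigamiFoldExistence.ShadowPleats

section InverseExtension

variable {M : Type} [TopologicalSpace M] [T2Space M] [SecondCountableTopology M]
  [ChartedSpace (EuclideanSpace ℝ (Fin 4)) M] [IsManifold (𝓡 4) ∞ M] [CompactSpace M]

/-- An injective continuous linear endomorphism of `ℝ⁴` is bijective (rank–nullity). -/
theorem bijective_of_injective_euclideanFour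
    {L : EuclideanSpace ℝ (Fin 4) →L[ℝ] EuclideanSpace ℝ (Fin 4)} (h : Injective L) : Bijective L :=
  ⟨h, LinearMap.surjective_of_injective (f := (L : EuclideanSpace ℝ (Fin 4) →ₗ[ℝ] EuclideanSpace ℝ (Fin 4))) h⟩

omit [T2Space M] [SecondCountableTopology M] [IsManifold (𝓡 4) ∞ M] [CompactSpace M] in
/-- The differential of `Ψ : M → S⁴` at `m` is injective iff that of `Subtype.val ∘ Ψ : M → ℝ⁵` is
(chain rule; the inclusion `S⁴ ↪ ℝ⁵` is an immersion, `mfderiv_coe_sphere_injective`). -/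
theorem injective_mfderiv_coe_comp_iff
    {Ψ : M → Metric.sphere (0 : EuclideanSpace ℝ (Fin 5)) 1} (hΨ : ContMDiff (𝓡 4) (𝓡 4) ∞ Ψ) (m : M) :
    Injective (mfderiv (𝓡 4) (𝓡 5) (fun x => (Ψ x : EuclideanSpace ℝ (Fin 5))) m) ↔
      Injective (mfderiv (𝓡 4) (𝓡 4) Ψ m) := by
  have hval : MDifferentiableAt (𝓡 4) (𝓡 5)
      (Subtype.val : Metric.sphere (0 : EuclideanSpace ℝ (Fin 5)) 1 → EuclideanSpace ℝ (Fin 5)) (Ψ m) :=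
    (contMDiff_coe_sphere (m := ∞) (n := 4) (E := EuclideanSpace ℝ (Fin 5)) (Ψ m)).mdifferentiableAt (by simp)
  have hd : MDifferentiableAt (𝓡 4) (𝓡 4) Ψ m := (hΨ m).mdifferentiableAt (by simp)
  have hcomp := mfderiv_comp m hval hd
  show Injective (mfderiv (𝓡 4) (𝓡 5)
    ((Subtype.val : Metric.sphere (0 : EuclideanSpace ℝ (Fin 5)) 1 → EuclideanSpace ℝ (Fin 5)) ∘ Ψ) m) ↔ _
  rw [hcomp]
  constructor
  · intro h v₁ v₂ hv
    apply h
    change mfderiv (𝓡 4) (𝓡 5)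
        (Subtype.val : Metric.sphere (0 : EuclideanSpace ℝ (Fin 5)) 1 → EuclideanSpace ℝ (Fin 5))
        (Ψ m) (mfderiv (𝓡 4) (𝓡 4) Ψ m v₁) =
      mfderiv (𝓡 4) (𝓡 5)
        (Subtype.val : Metric.sphere (0 : EuclideanSpace ℝ (Fin 5)) 1 → EuclideanSpace ℝ (Fin 5))
        (Ψ m) (mfderiv (𝓡 4) (𝓡 4) Ψ m v₂)
    rw [hv]
  · intro h v₁ v₂ hv
    exact h (mfderiv_coe_sphere_injective (n := 4) (Ψ m) hv)

omit [T2Space M] [SecondCountableTopology M] [CompactSpace M] in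
/-- **Embedding near a compact set.**  A smooth map `Ψ : M → S⁴` of a compact `4`-manifold which is injective on a
compact set `K` and has injective differential at every point of `K` is injective with BIJECTIVE differential on an
open neighbourhood of `K`. -/
theorem exists_isOpen_injOn_bijective_mfderiv
    {Ψ : M → Metric.sphere (0 : EuclideanSpace ℝ (Fin 5)) 1} (hΨ : ContMDiff (𝓡 4) (𝓡 4) ∞ Ψ)
    {K : Set M} (hK : IsCompact K) (hinj : InjOn Ψ K)
    (hd : ∀ m ∈ K, Injective (mfderiv (𝓡 4) (𝓡 4) Ψ m)) :
    ∃ W : Set M, IsOpen W ∧ K ⊆ W ∧ InjOn Ψ W ∧ ∀ m ∈ W, Bijective (mfderiv (𝓡 4) (𝓡 4) Ψ m) := by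
  -- Hirsch's Lemma 1.3 at each point of `K`, for the constant family `(t, x) ↦ (Ψ x : ℝ⁵)`
  have key : ∀ m ∈ K, ∃ N : Set M, IsOpen N ∧ m ∈ N ∧ InjOn Ψ N ∧
      ∀ x ∈ N, Injective (mfderiv (𝓡 4) (𝓡 4) Ψ x) := by
    intro m hm
    set F : ℝ → M → EuclideanSpace ℝ (Fin 5) := fun _ x => (Ψ x : EuclideanSpace ℝ (Fin 5)) with hF_def
    have hF : ContMDiffOn (𝓘(ℝ, ℝ).prod (𝓡 4)) 𝓘(ℝ, EuclideanSpace ℝ (Fin 5)) ∞ (uncurry F)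
        (univ ×ˢ univ) :=
      (((contMDiff_coe_sphere (m := ∞) (n := 4) (E := EuclideanSpace ℝ (Fin 5))).comp hΨ).comp
        contMDiff_snd).contMDiffOn
    obtain ⟨N, hNo, hmN, hev⟩ :=
      Literature.Geometry.Manifold.exists_isOpen_eventually_injOn_and_injective_mfderiv
        (J := 𝓘(ℝ, ℝ)) (I := 𝓡 4) isOpen_univ hF (by simp) (mem_univ (0 : ℝ)) m
        ((injective_mfderiv_coe_comp_iff hΨ m).2 (hd m hm))
    obtain ⟨h1, h2⟩ := hev.self_of_nhds
    refine ⟨N, hNo, hmN, fun x hx y hy hxy => h1 hx hy ?_,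
      fun x hx => (injective_mfderiv_coe_comp_iff hΨ x).1 (h2 x hx)⟩
    simp [hF_def, hxy]
  choose! N hNo hmN hNinj hNd using key
  -- injectivity on a neighbourhood of `K` (tube lemma), intersected with the immersion locus
  obtain ⟨O, hO, hKO, hinjO⟩ := Literature.Geometry.Manifold.exists_isOpen_injOn_of_isCompact hK
    hΨ.continuous hinj fun m hm => ⟨N m, (hNo m hm).mem_nhds (hmN m hm), hNinj m hm⟩
  refine ⟨O ∩ ⋃ m ∈ K, N m, hO.inter (isOpen_biUnion fun m hm => hNo m hm),
    fun m hm => ⟨hKO hm, mem_biUnion hm (hmN m hm)⟩, hinjO.mono inter_subset_left, ?_⟩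
  rintro x ⟨-, hx⟩
  obtain ⟨m, hm, hxm⟩ := mem_iUnion₂.1 hx
  exact bijective_of_injective_euclideanFour (hNd m hm x hxm)

omit [T2Space M] [SecondCountableTopology M] [CompactSpace M] in
/-- **Globally smooth left inverse near a compact set.**  If moreover the complement of `K` lies in the image of
one smooth chart `e₀ : ℝ⁴ ↪ M`, there is a SMOOTH `Φ : S⁴ → M` (defined on all of `S⁴`) with `Φ (Ψ m) = m` on an
open neighbourhood of `K`; consequently `Φ` is injective with injective differential on `Ψ '' K` and maps it onto
`K`.  (The smooth inverse of `Ψ` on the open image of the neighbourhood, cut off inside the chart: outside a smaller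
neighbourhood the inverse lands in the chart, where a smooth bump function interpolates it to a constant.) -/
theorem exists_contMDiff_leftInverse [Nonempty M]
    {Ψ : M → Metric.sphere (0 : EuclideanSpace ℝ (Fin 5)) 1} (hΨ : ContMDiff (𝓡 4) (𝓡 4) ∞ Ψ)
    {K : Set M} (hK : IsCompact K) {W : Set M} (hW : IsOpen W) (hKW : K ⊆ W) (hinj : InjOn Ψ W)
    (hd : ∀ m ∈ W, Bijective (mfderiv (𝓡 4) (𝓡 4) Ψ m))
    {e₀ : EuclideanSpace ℝ (Fin 4) → M} (he : Manifold.IsSmoothEmbedding (𝓡 4) (𝓡 4) ∞ e₀)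
    (hcov : Kᶜ ⊆ range e₀) :
    ∃ Φ : Metric.sphere (0 : EuclideanSpace ℝ (Fin 5)) 1 → M, ContMDiff (𝓡 4) (𝓡 4) ∞ Φ ∧
      (∃ W' : Set M, IsOpen W' ∧ K ⊆ W' ∧ W' ⊆ W ∧ ∀ m ∈ W', Φ (Ψ m) = m) ∧
      InjOn Φ (Ψ '' K) ∧ (∀ p ∈ Ψ '' K, Injective (mfderiv (𝓡 4) (𝓡 4) Φ p)) ∧ Φ '' (Ψ '' K) = K := by
  classical
  -- the smooth inverse `g` of `Ψ` on the open image `Ψ '' W`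
  set g : Metric.sphere (0 : EuclideanSpace ℝ (Fin 5)) 1 → M := invFunOn Ψ W with hg_def
  have hWo : IsOpen (Ψ '' W) :=
    Literature.Geometry.Manifold.isOpen_image_of_bijective_mfderiv hW hΨ.contMDiffOn hd
  have hg : ContMDiffOn (𝓡 4) (𝓡 4) ∞ g (Ψ '' W) :=
    Literature.Geometry.Manifold.contMDiffOn_invFunOn_of_bijective_mfderiv hW hΨ.contMDiffOn hinj hd
  have hgΨ : ∀ m ∈ W, g (Ψ m) = m := fun m hm =>
    Literature.Geometry.Manifold.invFunOn_apply hinj hm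
  -- the smooth inverse `ê` of the chart on its open range
  set ê : M → EuclideanSpace ℝ (Fin 4) := invFun e₀ with hê_def
  have hê : ContMDiffOn (𝓡 4) (𝓡 4) ∞ ê (range e₀) :=
    Literature.Geometry.Manifold.contMDiffOn_invFun_range he
  have heê : ∀ m ∈ range e₀, e₀ (ê m) = m := fun m hm => invFun_eq hm
  have hro : IsOpen (range e₀) :=
    (Literature.Topology.FourManifolds.Manifold.IsSmoothEmbedding.isOpenMap_of_finrank_eq he rfl).isOpen_range
  -- a smooth bump: `1` near the compact `Ψ '' K`, `0` near the closed `(Ψ '' W)ᶜ`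
  have hKc : IsClosed (Ψ '' K) := (hK.image hΨ.continuous).isClosed
  obtain ⟨χ, hχ0, hχ1, -⟩ := exists_contMDiffMap_zero_one_nhds_of_isClosed (𝓡 4) (n := ⊤)
    hWo.isClosed_compl hKc (Set.disjoint_compl_left_iff_subset.2 (image_mono hKW))
  obtain ⟨U₀, hU₀o, hWU₀, hχU₀⟩ := eventually_nhdsSet_iff_exists.1 hχ0
  obtain ⟨U₁, hU₁o, hKU₁, hχU₁⟩ := eventually_nhdsSet_iff_exists.1 hχ1
  -- the extension
  set F : Metric.sphere (0 : EuclideanSpace ℝ (Fin 5)) 1 → EuclideanSpace ℝ (Fin 4) :=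
    fun p => χ p • ê (g p) with hF_def
  set Φ : Metric.sphere (0 : EuclideanSpace ℝ (Fin 5)) 1 → M :=
    fun p => if p ∈ Ψ '' K then g p else e₀ (F p) with hΦ_def
  -- `Φ = g` on the open neighbourhood `U₁ ∩ Ψ '' W` of `Ψ '' K`
  have hΦg : ∀ p ∈ U₁ ∩ Ψ '' W, Φ p = g p := by
    rintro p ⟨hpU, hpW⟩
    by_cases hpK : p ∈ Ψ '' K
    · simp only [hΦ_def, if_pos hpK]
    · obtain ⟨m, hm, rfl⟩ := hpW
      have hmK : m ∉ K := fun h => hpK ⟨m, h, rfl⟩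
      simp only [hΦ_def, if_neg hpK, hF_def, hχU₁ _ hpU, one_smul, hgΨ m hm]
      exact heê m (hcov hmK)
  -- `F` is smooth off `Ψ '' K`
  have hFat : ∀ p, p ∉ Ψ '' K → ContMDiffAt (𝓡 4) (𝓡 4) ∞ F p := by
    intro p hpK
    by_cases hpW : p ∈ Ψ '' W
    · obtain ⟨m, hm, rfl⟩ := hpW
      have hmK : m ∉ K := fun h => hpK ⟨m, h, rfl⟩
      have hgat : ContMDiffAt (𝓡 4) (𝓡 4) ∞ g (Ψ m) := hg.contMDiffAt (hWo.mem_nhds ⟨m, hm, rfl⟩)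
      have hêat : ContMDiffAt (𝓡 4) (𝓡 4) ∞ ê (g (Ψ m)) := by
        rw [hgΨ m hm]
        exact hê.contMDiffAt (hro.mem_nhds (hcov hmK))
      exact (χ.contMDiff (Ψ m)).smul (hêat.comp (Ψ m) hgat)
    · have hev : F =ᶠ[𝓝 p] fun _ => 0 := by
        filter_upwards [hU₀o.mem_nhds (hWU₀ hpW)] with q hq
        simp only [hF_def, hχU₀ q hq, zero_smul]
      exact contMDiffAt_const.congr_of_eventuallyEq hev
  -- `Φ` is smooth
  have hΦ : ContMDiff (𝓡 4) (𝓡 4) ∞ Φ := by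
    intro p
    by_cases hp : p ∈ U₁ ∩ Ψ '' W
    · have hev : Φ =ᶠ[𝓝 p] g :=
        Filter.eventuallyEq_of_mem ((hU₁o.inter hWo).mem_nhds hp) hΦg
      exact (hg.contMDiffAt (hWo.mem_nhds hp.2)).congr_of_eventuallyEq hev
    · have hpK : p ∉ Ψ '' K := fun h => hp ⟨hKU₁ h, image_mono hKW h⟩
      have hev : Φ =ᶠ[𝓝 p] (e₀ ∘ F) := by
        filter_upwards [hKc.isOpen_compl.mem_nhds hpK] with q hq
        simp only [hΦ_def, if_neg (show q ∉ Ψ '' K from hq), Function.comp_apply]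
      exact ((he.contMDiff (F p)).comp p (hFat p hpK)).congr_of_eventuallyEq hev
  -- the neighbourhood `W'` on which `Φ ∘ Ψ = id`
  have hΦΨ : ∀ m ∈ W ∩ Ψ ⁻¹' U₁, Φ (Ψ m) = m := fun m hm => by
    rw [hΦg (Ψ m) ⟨hm.2, m, hm.1, rfl⟩, hgΨ m hm.1]
  have hKW' : K ⊆ W ∩ Ψ ⁻¹' U₁ := fun m hm => ⟨hKW hm, hKU₁ ⟨m, hm, rfl⟩⟩
  refine ⟨Φ, hΦ, ⟨W ∩ Ψ ⁻¹' U₁, hW.inter (hU₁o.preimage hΨ.continuous), hKW', inter_subset_left, hΦΨ⟩,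
    ?_, ?_, ?_⟩
  · rintro _ ⟨m, hm, rfl⟩ _ ⟨m', hm', rfl⟩ h
    rw [hΦΨ m (hKW' hm), hΦΨ m' (hKW' hm')] at h
    rw [h]
  · rintro _ ⟨m, hm, rfl⟩
    have hev : Φ =ᶠ[𝓝 (Ψ m)] g :=
      Filter.eventuallyEq_of_mem ((hU₁o.inter hWo).mem_nhds ⟨hKU₁ ⟨m, hm, rfl⟩, m, hKW hm, rfl⟩) hΦg
    rw [hev.mfderiv_eq]
    exact (Literature.Geometry.Manifold.bijective_mfderiv_invFunOn hW hΨ.contMDiffOn hinj hd (hKW hm)).1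
  · refine Subset.antisymm ?_ fun m hm => ⟨Ψ m, ⟨m, hm, rfl⟩, hΦΨ m (hKW' hm)⟩
    rintro _ ⟨_, ⟨m, hm, rfl⟩, rfl⟩
    rw [hΦΨ m (hKW' hm)]
    exact hm

end InverseExtension

end Summit.SmoothPoincare4.SmoothPoincare4.Theorems.OrigamiFoldExistence.ShadowPleats

end
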